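import Summits.NavierStokesRegularity.FluidComputer.TubeStage
import HarnessLib

/-!
# Restart of the certified tube at a kernel slice, part 1: the kernel run restarts at every chunk
# boundary (schedules, times, slice data)

Companion file of `TubeRestart.lean` (cell `pub-fluidc`, blueprint seat bp3, gen 15; the two files are
ONE text, split only because files of the summit's topic directory obey the 400-line rule; same
namespace `Summit.NavierStokesRegularity.FluidComputer.TubeStage`).  HONEST FRAMING (verbatim): low
prior, high value-of-information experiment on Tao's machine paradigm; NOT a claim that NS blows up.
Everything here concerns the 5-mode quadratic, energy-conserving TRUNCATION `thresholdCircuit` with an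
ABSTRACT forcing of sup-size `δ`; nothing is proved about the Navier–Stokes equations.

Contents: `run_chunkT` (the 48 kernel chunk theorems `run_0 … run_47` of gen 13, indexed — NO new
kernel evaluation), `run_fromT` / `run_toT` (the checker run restarts at / runs up to every recorded
slice `sT k`), the slice times `tT k` and remaining durations `TfromT k` with `tT k + TfromT k = T12t`,
and two recorded-data facts used by the restarted stage (`sT_ch_lt`: every slice before the last lies
below the read-out level; `sT_rotor`: output centres `≥ 0`, ellipse sizes `≤ 2.72·10⁻⁷`).

[cite: Tao2016AveragedNS, §5.5 Thm 5.3 (5.5)]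
-/

noncomputable section

open Set Filter Topology
open scoped Pointwise BigOperators

namespace Summit.NavierStokesRegularity.FluidComputer

open Literature.Analysis.FluidPDE.Tao2016AveragedNS
open Literature.Analysis.FluidPDE.FluidComputer
open Literature.Analysis.FluidPDE.FluidComputer.TubeTable
open Literature.Analysis.FluidPDE.FluidComputer.ThresholdLevelTable (GIt Gt Gt_valid GIt_mem Rbt)
open Literature.Analysis.FluidPDE.FluidComputer.ThresholdLevelTableL
  (LtL T₃L EoutL recut_transfer_reach LtL_B_zero LtL_C_zero)

namespace TubeStage

/-! ### §1. The kernel run restarts at every chunk boundary -/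

/-- Every chunk of the tube run passes (the 48 kernel theorems of gen 13, indexed). [folklore] -/
theorem run_chunkT : ∀ i < NT, runTube 60 12 GIt CLt Rt (sT i) (cT i) = some (sT (i + 1)) := by
  intro i hi
  simp only [NT] at hi
  interval_cases i
  · exact run_0
  · exact run_1
  · exact run_2
  · exact run_3
  · exact run_4
  · exact run_5
  · exact run_6
  · exact run_7
  · exact run_8
  · exact run_9
  · exact run_10
  · exact run_11
  · exact run_12
  · exact run_13
  · exact run_14
  · exact run_15
  · exact run_16
  · exact run_17
  · exact run_18
  · exact run_19
  · exact run_20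
  · exact run_21
  · exact run_22
  · exact run_23
  · exact run_24
  · exact run_25
  · exact run_26
  · exact run_27
  · exact run_28
  · exact run_29
  · exact run_30
  · exact run_31
  · exact run_32
  · exact run_33
  · exact run_34
  · exact run_35
  · exact run_36
  · exact run_37
  · exact run_38
  · exact run_39
  · exact run_40
  · exact run_41
  · exact run_42
  · exact run_43
  · exact run_44
  · exact run_45
  · exact run_46
  · exact run_47

/-- The schedule from chunk `k` on. [folklore] -/
def schedFromT (k : ℕ) : List ℕ := (List.range (NT - k)).flatMap fun i => cT (k + i)

/-- The schedule up to chunk `k`. [folklore] -/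
def schedToT (k : ℕ) : List ℕ := (List.range k).flatMap cT

/-- **RESTART.** From the recorded slice `sT k` the remaining schedule passes and ends in the final
state `sT 48` (crossing flag set, hull `HT`). [folklore] -/
theorem run_fromT {k : ℕ} (hk : k ≤ NT) :
    runTube 60 12 GIt CLt Rt (sT k) (schedFromT k) = some (sT NT) := by
  have h := runTube_chunks (fun i => sT (k + i)) (fun i => cT (k + i)) (NT - k)
    (fun i hi => run_chunkT (k + i) (by omega))
  simp only [Nat.add_zero] at h
  rw [Nat.add_sub_cancel' hk] at h
  exact h

/-- The run up to chunk `k` ends in the recorded slice `sT k`. [folklore] -/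
theorem run_toT {k : ℕ} (hk : k ≤ NT) :
    runTube 60 12 GIt CLt Rt (sT 0) (schedToT k) = some (sT k) :=
  runTube_chunks sT cT k fun i hi => run_chunkT i (by omega)

/-- The time of slice `k`. [folklore] -/
def tT (k : ℕ) : ℝ := ∑ i ∈ Finset.range k, dur (cT i)

/-- The duration of the remaining schedule. [folklore] -/
def TfromT (k : ℕ) : ℝ := dur (schedFromT k)

/-- [folklore] -/
theorem dur_schedToT (k : ℕ) : dur (schedToT k) = tT k := dur_chunks cT k

/-- `tT k + TfromT k = T12t`. [folklore] -/
theorem tT_add_TfromT {k : ℕ} (hk : k ≤ NT) : tT k + TfromT k = T12t := by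
  have hall : ∑ i ∈ Finset.range NT, dur (cT i) = T12t := by
    have h := dur_schedT; rwa [schedT, dur_chunks] at h
  rw [tT, TfromT, schedFromT, dur_chunks, ← Finset.sum_Ico_eq_sum_range (f := fun i => dur (cT i)),
    Finset.sum_range_add_sum_Ico _ hk, hall]

/-- [folklore] -/
theorem tT_nonneg (k : ℕ) : 0 ≤ tT k := Finset.sum_nonneg fun _ _ => dur_nonneg _

/-- [folklore] -/
theorem TfromT_nonneg (k : ℕ) : 0 ≤ TfromT k := dur_nonneg _

/-- [folklore] -/
theorem cT_ne_nil (j : ℕ) : cT j ≠ [] := by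
  unfold cT; split_ifs <;> simp

/-- [folklore] -/
theorem schedFromT_ne_nil {k : ℕ} (hk : k < NT) : schedFromT k ≠ [] := by
  obtain ⟨m, hm⟩ : ∃ m, NT - k = m + 1 := ⟨NT - k - 1, by omega⟩
  rw [schedFromT, hm, List.range_succ_eq_map, List.flatMap_cons]
  exact List.append_ne_nil_of_left_ne_nil (cT_ne_nil _) _

/-- [folklore] -/
theorem schedToT_ne_nil {k : ℕ} (hk : 0 < k) : schedToT k ≠ [] := by
  obtain ⟨m, hm⟩ : ∃ m, k = m + 1 := ⟨k - 1, by omega⟩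
  rw [schedToT, hm, List.range_succ_eq_map, List.flatMap_cons]
  exact List.append_ne_nil_of_left_ne_nil (cT_ne_nil _) _

/-- Every recorded slice before the last lies below the read-out level. [folklore] -/
theorem sT_ch_lt {k : ℕ} (hk : k < NT) : (sT k).B.ch < CLt := by
  simp only [NT] at hk
  interval_cases k <;> decide

/-- The rotor ellipses of the recorded slices: output centre `≥ 0`, size `≤ 2.72·10⁻⁷`. [folklore] -/
theorem sT_rotor {k : ℕ} (hk : k ≤ NT) : 0 ≤ (sT k).B.zc ∧ (sT k).B.V ≤ 313081695904 := by
  simp only [NT] at hk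
  interval_cases k <;> decide

end TubeStage

end Summit.NavierStokesRegularity.FluidComputer

end
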